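import Summits.BirchSwinnertonDyer.Rank1Residual.X11a.SelmerCompanionRoute
import HarnessLib

/-!
# Route (3e) SELMER COMPANION, III: the two budget shapes met by the census (class X11a = N7; cell
# `b2b-bsdres`, unit `b2b-bsdres-x11a`, gen 26)

HONEST FRAMING (run/shared/lean/b2b/bsd-rank1-residual/, verbatim in every file): the goal of the
cell is to DELETE the COMBINATION-SHAPED residual classes of the Birch–Swinnerton-Dyer formula for
ALL analytic-rank `≤ 1` elliptic curves over `ℚ` — "full BSD formula for every rank `≤ 1` curve in
class `C`" assembled STRICTLY from published theorems — so that the rank-`≤ 1` remainder becomes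
exactly the CONSTRUCTION-SHAPED classes, which are TYPED (missing-input `Prop`s), NOT attempted.
This is not "finishing BSD". CLASS-OWNERS.md: research routes; NO CLAIM BEYOND STATED CLASSES.
THEOREMS ONLY; nothing booked; no label moves. CONDITIONAL on the PUBLISHED binders GZK (`hGZK`),
Cassels–Tate (`hCT`), Tate uniformisation (`hU`, `hU2`) and on the per-pair finite data named.

The booking shape `bsdp_of_bsdp_partner_of_selmerCompanion` (file II) carries the budget
`p^{r_an(A)} · ∏_{v ∈ T} #E(ℚ_v)[p] · #(ℤ_v/p) ≤ p` with the local factor `#(ℤ_v/p)` (`= p` at the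
place of `p`, `= 1` elsewhere). The census of the route (`HOME/b2b-bsdres-x11a/g26/SELMER-COMPANION-CENSUS.md`)
meets the budget in exactly two shapes, recorded here with that factor evaluated
(`prod_natCard_quot_adicCompletionIntegers`: `∏_{v ∈ T} #(ℤ_v/p) = p^{[ℚ:ℚ]} = p` when `T` contains
the places of `S` above `p`; `natCard_quot_adicCompletionIntegers_eq_one` away from `p`):

* **Shape A — the place of `p` is the only lossy one** (`bsdp_of_bsdp_partner_of_selmerCompanion_lossy_at_p`):
  a RANK-ZERO closed partner `A` (`r_an(A) = 0`), `E(ℚ_p)[p] = 0` (e.g. `E` NON-SPLIT multiplicative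
  at `p`), and every place of `S` away from `p` of kind (i) `E(ℚ_v)[p] = 0` / (ii) both split
  multiplicative with `#A(ℚ_v)[p] ≤ p` / (iii) both multiplicative of the same twist type with
  `μ_p(ℚ_v) = 1` — nothing is asked at `p` itself (the partner may be good, additive or
  multiplicative there). 39 of the 40 census rows (all the `p = 3` residue cells, the ten non-split
  leaf cells at `5` with a good rank-`0` partner).
* **Shape B — the lossy places avoid `p`** (`bsdp_of_bsdp_partner_of_selmerCompanion_lossy_away`):
  every place of `S` above `p` is of kind (ii) or (iii) (both curves multiplicative at `p` of the same
  type), and the places of `T` (all prime to `p`) satisfy `p^{r_an(A)} · ∏_{v ∈ T} #E(ℚ_v)[p] ≤ p` —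
  e.g. a rank-`0` partner and ONE place with `#E(ℚ_v)[p] = p` (the census row `84960a1 ← 59040b1`,
  `T = {59}`), or a rank-`1` partner and no lossy place at all.

References: file I/II docstrings; [MazurRubin2004] §2.3; [Miller2011LMS] Def. 1.1; [MilneADT2006]
I Lemma 3.3 (`#(𝓞_v/p)` factors); HOME/b2b-bsdres-x11a/REPORT-g26.md.
-/

set_option autoImplicit false

noncomputable section

open scoped Classical

open WeierstrassCurve Literature.NumberTheory.EllipticCurves
  Literature.NumberTheory.GaloisRepresentations Field NumberField IsDedekindDomain
  Literature.NumberTheory.EllipticCurves.Rank1Residual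
  Literature.NumberTheory.EllipticCurves.Rank1Residual.Typed

namespace Summit.BirchSwinnertonDyer.Rank1Residual.X11a.SelmerCompanion

section Shapes

variable (W A : WeierstrassCurve ℚ) [W.IsElliptic] [A.IsElliptic] (p : ℕ) [Fact p.Prime]

/-- **Shape A: the place of `p` is the only lossy place.** Route (3e) for a rank-`0` pair `(E, p)`
(`p` odd, `E[p]` irreducible, `p ∤ #Ш_an`) from a CLOSED `p`-congruent partner `A` of analytic rank `0`
with `p ∤ #Ш(A)_an`, when `E(ℚ_v)[p] = 0` at every place `v ∈ S` above `p` and every place of `S`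
away from `p` is of kind (i) `E(ℚ_v)[p] = 0`, (ii) both split multiplicative with `#A(ℚ_v)[p] ≤ p`,
or (iii) both multiplicative of the same twist type with `μ_p(ℚ_v) = 1`. (Budget: `T` = the places
of `S` above `p`; `p^0 · ∏_{v ∈ T} 1 · #(ℤ_v/p) = p^{[ℚ:ℚ]} = p`.) No hypothesis on `A` at `p`.
Not a class theorem; nothing booked. [cite: MazurRubin2004, §2.3] [cite: Miller2011LMS, §1 and Def. 1.1]
[cite: MilneADT2006, I Lemma 3.3] -/
theorem bsdp_of_bsdp_partner_of_selmerCompanion_lossy_at_p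
    (hU : Silverman1994_thmV53_tateUniformisation.{0})
    (hU2 : Silverman1994_thmV53_corV54_tateUniformisation.{0})
    (hGZK : rank_eq_analyticRank_of_analyticRank_le_one)
    (hCT : exists_casselsTate_pairing (K := ℚ)) (hp2 : p ≠ 2)
    (hr : W.analyticRank = 0) (hirr : Irr W p) (hSha : X11a.ShaAnUnit W p)
    (hbsdA : BSDp A p) (hShaA : X11a.ShaAnUnit A p) (hrA : A.analyticRank = 0)
    (e : geomTorsion A (p : ℤ) ≃+ geomTorsion W (p : ℤ))
    (he : ∀ (σ : absoluteGaloisGroup ℚ) (P : geomTorsion A (p : ℤ)), e (σ • P) = σ • e P)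
    (S : Finset (HeightOneSpectrum (𝓞 ℚ)))
    (hS : ∀ v : HeightOneSpectrum (𝓞 ℚ), v ∉ S →
      A.HasGoodReductionAt v ∧ W.HasGoodReductionAt v ∧ (p : 𝓞 ℚ) ∉ v.asIdeal)
    (hat : ∀ v ∈ S, (p : 𝓞 ℚ) ∈ v.asIdeal → Nat.card (nsmulAddMonoidHom p :
        (W.baseChange (v.adicCompletion ℚ)).toAffine.Point →+ _).ker = 1)
    (haway : ∀ v ∈ S, (p : 𝓞 ℚ) ∉ v.asIdeal →
      Nat.card (nsmulAddMonoidHom p :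
          (W.baseChange (v.adicCompletion ℚ)).toAffine.Point →+ _).ker = 1 ∨
      (A.HasSplitMultiplicativeReductionAt v ∧ W.HasSplitMultiplicativeReductionAt v ∧
        Nat.card (nsmulAddMonoidHom p :
          (A.baseChange (v.adicCompletion ℚ)).toAffine.Point →+ _).ker ≤ p) ∨
      (A.HasMultiplicativeReductionAt v ∧ W.HasMultiplicativeReductionAt v ∧
        (∃ r : v.adicCompletion ℚ, algebraMap ℚ (v.adicCompletion ℚ) (-(A.c₄ / A.c₆)) =
          r ^ 2 * algebraMap ℚ (v.adicCompletion ℚ) (-(W.c₄ / W.c₆))) ∧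
        (∀ ζ : v.adicCompletion ℚ, ζ ^ p = 1 → ζ = 1))) :
    BSDp W p := by
  classical
  set T := S.filter (fun v ↦ (p : 𝓞 ℚ) ∈ v.asIdeal) with hT
  have hTS : T ⊆ S := Finset.filter_subset _ _
  refine bsdp_of_bsdp_partner_of_selmerCompanion W A p hU hU2 hGZK hCT hp2 hr hirr hSha hbsdA hShaA
    e he S T hTS hS (fun v hv hvT ↦ ?_) ?_
  · have hvp : (p : 𝓞 ℚ) ∉ v.asIdeal := fun h ↦ hvT (Finset.mem_filter.mpr ⟨hv, h⟩)
    rcases haway v hv hvp with h1 | h2 | h3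
    · exact Or.inl ⟨hvp, h1⟩
    · exact Or.inr (Or.inl h2)
    · exact Or.inr (Or.inr h3)
  · -- the budget: `p^0 · ∏_{v ∈ T} 1 · #(ℤ_v/p) = p`
    have hprod : ∏ v ∈ T, (Nat.card (nsmulAddMonoidHom p :
          (W.baseChange (v.adicCompletion ℚ)).toAffine.Point →+ _).ker *
        Nat.card (v.adicCompletionIntegers ℚ ⧸ Ideal.span {(p : v.adicCompletionIntegers ℚ)})) =
        ∏ v ∈ T, Nat.card (v.adicCompletionIntegers ℚ ⧸
          Ideal.span {(p : v.adicCompletionIntegers ℚ)}) := by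
      refine Finset.prod_congr rfl fun v hv ↦ ?_
      rw [Finset.mem_filter] at hv
      rw [hat v hv.1 hv.2, one_mul]
    have hTout : ∀ v : HeightOneSpectrum (𝓞 ℚ), v ∉ T → (p : 𝓞 ℚ) ∉ v.asIdeal := by
      intro v hv hpv
      by_cases hvS : v ∈ S
      · exact hv (Finset.mem_filter.mpr ⟨hvS, hpv⟩)
      · exact (hS v hvS).2.2 hpv
    rw [hrA, pow_zero, one_mul, hprod, prod_natCard_quot_adicCompletionIntegers T hTout,
      Module.finrank_self, pow_one]

/-- **Shape B: the lossy places avoid `p`.** Route (3e) for a rank-`0` pair `(E, p)` (`p` odd, `E[p]`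
irreducible, `p ∤ #Ш_an`) from a CLOSED `p`-congruent partner `A` (`r_an(A) ≤ 1`, `p ∤ #Ш(A)_an`) when
every place of `S` above `p` is of kind (ii) or (iii) (both curves multiplicative at `p`, of the same
type), the places of `S \ T` away from `p` are of kinds (i)–(iii), and the lossy set `T` (prime to `p`)
satisfies `p^{r_an(A)} · ∏_{v ∈ T} #E(ℚ_v)[p] ≤ p` (the factors `#(ℤ_v/p)` are `1` on `T`). E.g. a
rank-`0` partner and one place with `#E(ℚ_v)[p] = p`; a rank-`1` partner and `T = ∅`. Not a class
theorem; nothing booked. [cite: MazurRubin2004, §2.3] [cite: Miller2011LMS, §1 and Def. 1.1]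
[cite: MilneADT2006, I Lemma 3.3] -/
theorem bsdp_of_bsdp_partner_of_selmerCompanion_lossy_away
    (hU : Silverman1994_thmV53_tateUniformisation.{0})
    (hU2 : Silverman1994_thmV53_corV54_tateUniformisation.{0})
    (hGZK : rank_eq_analyticRank_of_analyticRank_le_one)
    (hCT : exists_casselsTate_pairing (K := ℚ)) (hp2 : p ≠ 2)
    (hr : W.analyticRank = 0) (hirr : Irr W p) (hSha : X11a.ShaAnUnit W p)
    (hbsdA : BSDp A p) (hShaA : X11a.ShaAnUnit A p)
    (e : geomTorsion A (p : ℤ) ≃+ geomTorsion W (p : ℤ))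
    (he : ∀ (σ : absoluteGaloisGroup ℚ) (P : geomTorsion A (p : ℤ)), e (σ • P) = σ • e P)
    (S T : Finset (HeightOneSpectrum (𝓞 ℚ))) (hTS : T ⊆ S)
    (hTp : ∀ v ∈ T, (p : 𝓞 ℚ) ∉ v.asIdeal)
    (hS : ∀ v : HeightOneSpectrum (𝓞 ℚ), v ∉ S →
      A.HasGoodReductionAt v ∧ W.HasGoodReductionAt v ∧ (p : 𝓞 ℚ) ∉ v.asIdeal)
    (hplaces : ∀ v ∈ S, v ∉ T →
      ((p : 𝓞 ℚ) ∉ v.asIdeal ∧ Nat.card (nsmulAddMonoidHom p :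
          (W.baseChange (v.adicCompletion ℚ)).toAffine.Point →+ _).ker = 1) ∨
      (A.HasSplitMultiplicativeReductionAt v ∧ W.HasSplitMultiplicativeReductionAt v ∧
        Nat.card (nsmulAddMonoidHom p :
          (A.baseChange (v.adicCompletion ℚ)).toAffine.Point →+ _).ker ≤ p) ∨
      (A.HasMultiplicativeReductionAt v ∧ W.HasMultiplicativeReductionAt v ∧
        (∃ r : v.adicCompletion ℚ, algebraMap ℚ (v.adicCompletion ℚ) (-(A.c₄ / A.c₆)) =
          r ^ 2 * algebraMap ℚ (v.adicCompletion ℚ) (-(W.c₄ / W.c₆))) ∧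
        (∀ ζ : v.adicCompletion ℚ, ζ ^ p = 1 → ζ = 1)))
    (hbudget : p ^ A.analyticRank * ∏ v ∈ T, Nat.card (nsmulAddMonoidHom p :
        (W.baseChange (v.adicCompletion ℚ)).toAffine.Point →+ _).ker ≤ p) :
    BSDp W p := by
  refine bsdp_of_bsdp_partner_of_selmerCompanion W A p hU hU2 hGZK hCT hp2 hr hirr hSha hbsdA hShaA
    e he S T hTS hS hplaces ?_
  have hprod : ∏ v ∈ T, (Nat.card (nsmulAddMonoidHom p :
        (W.baseChange (v.adicCompletion ℚ)).toAffine.Point →+ _).ker *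
      Nat.card (v.adicCompletionIntegers ℚ ⧸ Ideal.span {(p : v.adicCompletionIntegers ℚ)})) =
      ∏ v ∈ T, Nat.card (nsmulAddMonoidHom p :
        (W.baseChange (v.adicCompletion ℚ)).toAffine.Point →+ _).ker := by
    refine Finset.prod_congr rfl fun v hv ↦ ?_
    rw [natCard_quot_adicCompletionIntegers_eq_one (hTp v hv), mul_one]
  rw [hprod]
  exact hbudget

end Shapes

end Summit.BirchSwinnertonDyer.Rank1Residual.X11a.SelmerCompanion

end
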